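import Literature.NumberTheory.LFunctions.ClassGroupLFunctionZeroCount
import Literature.NumberTheory.LFunctions.ClassGroupLFunctionEntire
import Literature.NumberTheory.LFunctions.UniformTwistedZeroFreeRegion
import Literature.NumberTheory.LFunctions.UniformClassGroupPNTInputs
import HarnessLib

/-!
# The zero-free region for class group `L`-functions, uniformly in the field (TZ Theorem 3.1)

Topic `Literature/NumberTheory/LFunctions` (namespace `Literature.NumberTheory.LFunctions.NumberField`).
Everything in this file is PROVED (theorems only).

For a number field `K` of degree `n_K` and a NON-TRIVIAL class group character
`χ : Cl_K →* ℂˣ` we verify the hypotheses `UniformTwistedZFRData` of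
`UniformTwistedZeroFreeRegion.lean` (Montgomery–Vaughan's proof of Theorem 11.3, abstract form with
the conductor parameter allowed to absorb the discriminant) for

* `F = L₀(·, χ)` — the entire function `dslope Z₁_χ 1 = L(s, χ)` (`ClassGroupLFunctionEntire.lean`),
* `Q = |d_K|`, `η = 1`, `Λ₀ = Λ_K`, `Λ₁ = Λ_χ = χΛ_K`, `Λ₂ = Λ_{χ²}`, `pole = (χ² = 1)`,
* numeric parameters depending on `n_K` ALONE: `A = n_K + 1`, `C_g = 2e^{2n_K}(3/2)^{n_K+1}`,
  `c₁ = 32 e^{−32 n_K}`, `K₀ = 77760(5n_K + 2)`, `C₂ = 77760(5n_K + 2) + 1`.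

The inputs, all uniform in `K` and `χ`:

* `re_LSeries_vonMangoldtNorm_le` — **Stark-type bound for `−ζ_K'/ζ_K`**:
  `Re(−ζ_K'/ζ_K)(s) ≤ Re 1/(s−1) + 77760 M_K(t)` for `1 < σ ≤ 2`,
  `M_K(t) = log|d_K| + 3n_K + (n_K+1)log(|t|+7)`, from the local partial fraction of `ζ₁_K'/ζ₁_K`
  (`DedekindZetaPartialFraction.lean`, Lagarias–Odlyzko Lemma 5.6) by dropping the zeros
  (`Re 1/(s − ρ) ≥ 0`); at `t = 0` this is `re_LSeries₀_le` with `K₀(log|d_K| + log 4)`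
  ([LagariasOdlyzko1977, Lemma 5.3]; [Stark1974, Lemma 1 (b)] has `½ log|d_K|`);
* `re_LSeries_twistVonMangoldt_le` — the same for `−L'/L(s, ψ)`, `ψ ≠ 1`:
  `Re(−L'/L)(s, ψ) ≤ 1 + 77760 M_K(t)` (partial fraction of `Z₁_ψ'/Z₁_ψ`,
  `ClassGroupLFunctionZeroCount.lean`; the zero of `Z₁_ψ = (s−1)L(s,ψ)` at `s = 1` cancels the
  term `1/(s − 1)` when `|t|` is small);
* `norm_classGroupLFunction₀_le` — **growth**: `|L₀(s, χ)| ≤ 2|d_K| e^{2n_K} (|t| + 6)^{n_K+1}` for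
  `−1/2 ≤ σ ≤ 3` (convexity bound of `ClassGroupLFunctionConvexity.lean` for `Z₁_χ`, and the
  maximum modulus principle on `|s − 1| ≤ 1/2`);
* `exp_neg_finrank_div_le_norm_classGroupLFunction` (lower bound `e^{−n_K/(σ−1)}`),
  `three_four_one_classGroupChar` (`3–4–1`), `neg_logDeriv_classGroupLFunction_eq` (`F'/F = −L(Λ_χ)`);
* `conj_classGroupLFunction₀_conj`, `classGroupLFunction₀_conj_eq_zero` — **reflection** for a
  real character: `L₀(s̄, χ) = conj L₀(s, χ)`, so the zeros are symmetric (identity theorem from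
  `σ > 1`, where the Dirichlet coefficients `Σ_{N𝔞=n} χ(𝔞) ∈ ℝ`).

Main results:

* `uniformTwistedZFRData_classGroupLFunction₀_of_ne` (`χ² ≠ 1`, `pole = false`) and
  `uniformTwistedZFRData_classGroupLFunction₀_of_eq` (`χ² = 1`, `χ ≠ 1`, `pole = true`);
* `exists_zeroFree_classGroupLFunction₀` — **the zero-free region, uniformly in the field**
  ([ThornerZaman2019, Theorem 3.1] for the class group characters `χ ≠ 1` of the fields of a
  given degree; Lagarias–Odlyzko [LO, Lemma 8.1]): for every `n` there is `c = c(n) > 0` such that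
  for every number field `K` of degree `n`, every class group character `χ ≠ 1` and every zero
  `ρ = β + iγ` of `L(s, χ)` with `β > 1 − c/(log|d_K| + log(|γ| + 4))`, `χ` is real (`χ² = 1`) and
  `γ = 0`.  (That there is at most one such zero among all `χ`, and that it is simple — the
  remaining clauses of TZ Theorem 3.1 — is Landau–Page, not done here; the trivial character,
  `ζ_K`, is `DedekindZetaClassicalRegionBounds.lean` / the Kronecker factorisation for quadratic `K`.)

## References

* J. Thorner, A. Zaman, *A unified and improved Chebotarev density theorem*, Algebra & Number
  Theory 13 (2019), Theorem 3.1, Lemma 2.6. [ThornerZaman2019]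
* J. C. Lagarias, A. M. Odlyzko, *Effective versions of the Chebotarev density theorem* (1977),
  Lemmas 5.3, 5.6, 8.1. [LagariasOdlyzko1977]
* H. L. Montgomery, R. C. Vaughan, *Multiplicative Number Theory I*, CUP 2007, §11.1.
  [MontgomeryVaughan2007]
-/

noncomputable section

open scoped NumberField nonZeroDivisors ComplexConjugate
open Complex Filter Topology Set Metric MeromorphicOn NumberField

namespace Literature.NumberTheory.LFunctions.NumberField

variable {K : Type*} [Field K] [NumberField K]

/-! ### Elementary: the disc bound against `log|d_K| + log(|t| + 4)` -/

/-- `log(|t| + 7) ≤ 2 log(|t| + 4)` (`|t| + 7 ≤ (|t| + 4)²`). [folklore] -/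
theorem log_abs_add_seven_le (t : ℝ) : Real.log (|t| + 7) ≤ 2 * Real.log (|t| + 4) := by
  rw [← Real.log_rpow (by positivity), Real.rpow_two]
  exact Real.log_le_log (by positivity) (by nlinarith [abs_nonneg t])

/-- `M_K(t) ≤ (5n_K + 2)(log|d_K| + log(|t| + 4))`. [folklore] -/
theorem discBound_le (t : ℝ) :
    discBound K t ≤ (5 * Module.finrank ℚ K + 2) *
      (Real.log ((discr K).natAbs : ℝ) + Real.log (|t| + 4)) := by
  unfold discBound
  have h1 : 0 ≤ Real.log ((discr K).natAbs : ℝ) := Real.log_natCast_nonneg _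
  have h2 : (1 : ℝ) ≤ Module.finrank ℚ K := by exact_mod_cast Module.finrank_pos (R := ℚ) (M := K)
  have h3 := log_abs_add_seven_le t
  have h4 : 1 ≤ Real.log (|t| + 4) := ClassicalZFRData.one_le_log_tau t
  nlinarith

/-- `M_K(0) ≤ (5n_K + 2)(log|d_K| + log 4)`. [folklore] -/
theorem discBound_zero_le :
    discBound K 0 ≤ (5 * Module.finrank ℚ K + 2) * (Real.log ((discr K).natAbs : ℝ) + Real.log 4) := by
  have := discBound_le (K := K) 0
  rwa [abs_zero, zero_add] at this

/-! ### Stark-type bound for `−ζ_K'/ζ_K` to the right of `σ = 1`, uniformly in `K` -/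

/-- For `Re s > 1`: `ζ₁_K'/ζ₁_K(s) = 1/(s − 1) − L(Λ_K, s)`. [folklore] -/
theorem logDeriv_dedekindZeta₁_eq {s : ℂ} (hs : 1 < s.re) :
    logDeriv (dedekindZeta₁ K) s = 1 / (s - 1) - LSeries (fun n ↦ (vonMangoldtNorm K n : ℂ)) s := by
  have hev : dedekindZeta₁ K =ᶠ[𝓝 s] fun z ↦ (z - 1) * _root_.NumberField.dedekindZeta K z := by
    have hmem : {z : ℂ | 1 < z.re} ∈ 𝓝 s := (isOpen_lt continuous_const continuous_re).mem_nhds hs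
    filter_upwards [hmem] with z hz
    exact dedekindZeta₁_apply_eq_mul hz
  rw [logDeriv_apply, hev.deriv_eq, dedekindZeta₁_apply_eq_mul hs, logDeriv_sub_one_mul_dedekindZeta K hs,
    LSeries_vonMangoldtNorm_eq hs]

/-- **`Re(−ζ_K'/ζ_K)(s) ≤ Re 1/(s − 1) + 77760 M_K(t)` for `1 < σ ≤ 2`** (`s = σ + it`), uniformly
in `K`: the local partial fraction `ζ₁_K'/ζ₁_K(s) = Σ_ρ m(ρ)/(s − ρ) + O(M_K(t))`
(`norm_logDeriv_dedekindZeta₁_sub_sum_le`, Lagarias–Odlyzko Lemma 5.6) and `Re 1/(s − ρ) > 0` for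
the zeros (`Re ρ < 1 < σ`). This is the uniform substitute for Stark's
`−ζ_K'/ζ_K(σ) < 1/(σ−1) + ½ log|d_K| + O(n_K)`. [cite: LagariasOdlyzko1977, Lemma 5.3] -/
theorem re_LSeries_vonMangoldtNorm_le {s : ℂ} (hs : 1 < s.re) (hs2 : s.re ≤ 2) :
    (LSeries (fun n ↦ (vonMangoldtNorm K n : ℂ)) s).re ≤
      (1 / (s - 1)).re + 77760 * discBound K s.im := by
  classical
  set t : ℝ := s.im with ht
  set c : ℂ := 2 + t * I with hc
  have hsc : s ∈ closedBall c (7 / 4) := by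
    rw [mem_closedBall, dist_eq_norm]
    have : s - c = ((s.re - 2 : ℝ) : ℂ) := by
      apply Complex.ext <;> simp [hc, ht]
    rw [this, Complex.norm_real, Real.norm_eq_abs, abs_le]
    constructor <;> linarith
  have hζs : dedekindZeta₁ K s ≠ 0 := dedekindZeta₁_ne_zero_of_one_le_re hs.le
  have hpf := norm_logDeriv_dedekindZeta₁_sub_sum_le K t hsc hζs
  set D := divisor (dedekindZeta₁ K) (closedBall c (31 / 16)) with hD
  set S := (D.finiteSupport (isCompact_closedBall _ _)).toFinset with hS
  -- the sum over zeros has non-negative real part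
  have hsum : 0 ≤ (∑ u ∈ S, (D u : ℂ) / (s - u)).re := by
    rw [Complex.re_sum]
    refine Finset.sum_nonneg fun u hu ↦ ?_
    obtain ⟨-, -, -, hu1⟩ := zero_of_mem_support_divisor_bigDisc hu
    have hDu : (0 : ℝ) ≤ D u := by exact_mod_cast divisor_dedekindZeta₁_nonneg K c (31 / 16) u
    have hre : ((D u : ℂ) / (s - u)).re = (D u : ℝ) * ((s - u)⁻¹).re := by
      rw [div_eq_mul_inv, show ((D u : ℤ) : ℂ) = ((D u : ℝ) : ℂ) by simp, Complex.re_ofReal_mul]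
    rw [hre]
    refine mul_nonneg hDu ?_
    rw [Complex.inv_re]
    exact div_nonneg (by simp; linarith) (Complex.normSq_nonneg _)
  have hL : LSeries (fun n ↦ (vonMangoldtNorm K n : ℂ)) s =
      1 / (s - 1) - (∑ u ∈ S, (D u : ℂ) / (s - u)) -
        (logDeriv (dedekindZeta₁ K) s - ∑ u ∈ S, (D u : ℂ) / (s - u)) := by
    rw [logDeriv_dedekindZeta₁_eq hs]; ring
  rw [hL, Complex.sub_re, Complex.sub_re]
  have h1 := Complex.abs_re_le_norm (logDeriv (dedekindZeta₁ K) s - ∑ u ∈ S, (D u : ℂ) / (s - u))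
  have h2 := neg_abs_le (logDeriv (dedekindZeta₁ K) s - ∑ u ∈ S, (D u : ℂ) / (s - u)).re
  linarith

/-- At real `σ ∈ (1, 2]`: `L(Λ_K, σ) ≤ 1/(σ − 1) + 77760(5n_K + 2)(log|d_K| + log 4)` — the
hypothesis `re_LSeries₀_le` of `UniformTwistedZFRData` with `Q = |d_K|`, `K₀ = 77760(5n_K + 2)`.
[cite: LagariasOdlyzko1977, Lemma 5.3] -/
theorem re_LSeries_vonMangoldtNorm_ofReal_le {σ : ℝ} (hσ : 1 < σ) (hσ2 : σ ≤ 2) :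
    (LSeries (fun n ↦ (vonMangoldtNorm K n : ℂ)) σ).re ≤
      1 / (σ - 1) + 77760 * (5 * Module.finrank ℚ K + 2) *
        (Real.log ((discr K).natAbs : ℝ) + Real.log 4) := by
  have h := re_LSeries_vonMangoldtNorm_le (K := K) (s := (σ : ℂ)) (by simpa using hσ) (by simpa using hσ2)
  have h1 : (1 / ((σ : ℂ) - 1)).re = 1 / (σ - 1) := by
    rw [show (σ : ℂ) - 1 = ((σ - 1 : ℝ) : ℂ) by push_cast; ring, ← Complex.ofReal_one,
      ← Complex.ofReal_div, Complex.ofReal_re]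
  rw [h1, Complex.ofReal_im] at h
  have h2 := discBound_zero_le (K := K)
  nlinarith

/-! ### The same for `−L'/L(s, ψ)`, `ψ ≠ 1` -/

/-- `Z₁_ψ ≠ 0` on `Re s > 1` (`Z₁_ψ(s) = (s − 1)L(s, ψ)`). [folklore] -/
theorem classTwistedZeta₁_ne_zero_of_one_lt_re (ψ : ClassGroup (𝓞 K) →* ℂˣ) {s : ℂ} (hs : 1 < s.re) :
    classTwistedZeta₁ K (fun C ↦ (ψ C : ℂ)) s ≠ 0 := by
  have hs1 : s ≠ 1 := fun h ↦ by rw [h, one_re] at hs; exact lt_irrefl _ hs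
  rw [← sub_one_mul_classGroupLFunction ψ hs1]
  exact mul_ne_zero (sub_ne_zero.mpr hs1) (classGroupLFunction_ne_zero_of_one_lt_re K ψ hs)

/-- A zero of `Z₁_ψ` has `Re ρ ≤ 1`. [folklore] -/
theorem re_le_one_of_classTwistedZeta₁_eq_zero (ψ : ClassGroup (𝓞 K) →* ℂˣ) {ρ : ℂ}
    (hρ : classTwistedZeta₁ K (fun C ↦ (ψ C : ℂ)) ρ = 0) : ρ.re ≤ 1 := by
  by_contra h
  exact classTwistedZeta₁_ne_zero_of_one_lt_re ψ (not_le.mp h) hρ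

/-- `Z₁_ψ` is not locally zero anywhere (it is entire and `Z₁_ψ(2) ≠ 0`). [folklore] -/
theorem analyticOrderAt_classTwistedZeta₁_ne_top (ψ : ClassGroup (𝓞 K) →* ℂˣ) (z : ℂ) :
    analyticOrderAt (classTwistedZeta₁ K (fun C ↦ (ψ C : ℂ))) z ≠ ⊤ := by
  intro htop
  rw [analyticOrderAt_eq_top] at htop
  have han := analyticOnNhd_classTwistedZeta₁ (K := K) (fun C ↦ (ψ C : ℂ)) Set.univ
  have hzero := han.eqOn_zero_of_preconnected_of_eventuallyEq_zero isPreconnected_univ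
    (Set.mem_univ z) htop (Set.mem_univ (2 + (0 : ℝ) * I))
  exact classTwistedZeta₁_two_add_ne_zero ψ 0 hzero

/-- For `ψ ≠ 1`, the point `s = 1` carries multiplicity `≥ 1` in the divisor of `Z₁_ψ` on any closed
disc containing it (`Z₁_ψ(1) = 0`). [folklore] -/
theorem one_le_divisor_classTwistedZeta₁_one {ψ : ClassGroup (𝓞 K) →* ℂˣ} (hψ : ψ ≠ 1) {c : ℂ} {R : ℝ}
    (h1 : (1 : ℂ) ∈ closedBall c R) :
    1 ≤ divisor (classTwistedZeta₁ K (fun C ↦ (ψ C : ℂ))) (closedBall c R) 1 := by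
  set f := classTwistedZeta₁ K (fun C ↦ (ψ C : ℂ)) with hf
  have han := analyticOnNhd_classTwistedZeta₁ (K := K) (fun C ↦ (ψ C : ℂ)) (closedBall c R)
  have hfa : AnalyticAt ℂ f 1 := (differentiable_classTwistedZeta₁ _).analyticAt 1
  rw [divisor_apply han.meromorphicOn h1, hfa.meromorphicOrderAt_eq]
  have hne0 : analyticOrderAt f 1 ≠ 0 := by
    rw [ne_eq, hfa.analyticOrderAt_eq_zero, not_not]
    exact classTwistedZeta₁_one_eq_zero hψ
  have hnetop : analyticOrderAt f 1 ≠ ⊤ := analyticOrderAt_classTwistedZeta₁_ne_top ψ 1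
  obtain ⟨k, hk⟩ := ENat.ne_top_iff_exists.mp hnetop
  rw [← hk] at hne0 ⊢
  have hk1 : 1 ≤ k := Nat.one_le_iff_ne_zero.mpr (by simpa using hne0)
  simp only [ENat.map_coe, WithTop.untop₀_coe]
  exact_mod_cast hk1

/-- For `Re s > 1` and `ψ ≠ 1`: `Z₁_ψ'/Z₁_ψ(s) = 1/(s − 1) − L(Λ_ψ, s)`. [folklore] -/
theorem logDeriv_classTwistedZeta₁_eq (ψ : ClassGroup (𝓞 K) →* ℂˣ) {s : ℂ} (hs : 1 < s.re) :
    logDeriv (classTwistedZeta₁ K (fun C ↦ (ψ C : ℂ))) s =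
      1 / (s - 1) - LSeries (twistVonMangoldt K (classGroupCharIdealHom ψ)) s := by
  have hs1 : s ≠ 1 := fun h ↦ by rw [h, one_re] at hs; exact lt_irrefl _ hs
  have hev : classTwistedZeta₁ K (fun C ↦ (ψ C : ℂ)) =ᶠ[𝓝 s]
      fun z ↦ (z - 1) * classGroupLFunction K ψ z := by
    have hmem : ({1}ᶜ : Set ℂ) ∈ 𝓝 s := isOpen_compl_singleton.mem_nhds hs1
    filter_upwards [hmem] with z hz
    exact (sub_one_mul_classGroupLFunction ψ hz).symm
  have hdiffL : DifferentiableAt ℂ (classGroupLFunction K ψ) s := by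
    have := (differentiableOn_classTwistedZeta (K := K) (fun C ↦ (ψ C : ℂ))) s hs1
    rw [← funext (classGroupLFunction_eq_classTwistedZeta ψ)] at this
    exact this.differentiableAt (isOpen_compl_singleton.mem_nhds hs1)
  have hd : HasDerivAt (fun z ↦ (z - 1) * classGroupLFunction K ψ z)
      (1 * classGroupLFunction K ψ s + (s - 1) * deriv (classGroupLFunction K ψ) s) s :=
    ((hasDerivAt_id' s).sub_const 1).mul hdiffL.hasDerivAt
  have hL0 := classGroupLFunction_ne_zero_of_one_lt_re K ψ hs
  rw [logDeriv_apply, hev.deriv_eq, hd.deriv, ← sub_one_mul_classGroupLFunction ψ hs1,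
    ← neg_logDeriv_classGroupLFunction_eq K ψ hs]
  field_simp [sub_ne_zero.mpr hs1, hL0]
  ring

/-- **`Re(−L'/L)(s, ψ) ≤ 1 + 77760 M_K(t)` for `1 < σ ≤ 2` and `ψ ≠ 1`**, uniformly in `K` and
`ψ`: the local partial fraction of `Z₁_ψ'/Z₁_ψ` (`norm_logDeriv_classTwistedZeta₁_sub_sum_le`)
with `Re 1/(s − ρ) ≥ 0` for all zeros; the term `1/(s − 1)` of `Z₁_ψ'/Z₁_ψ = L'/L + 1/(s − 1)` is
cancelled by the zero `ρ = 1` of `Z₁_ψ` when `1` lies in the disc, and is `≤ 1` otherwise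
(`|t| > 1`). [cite: ThornerZaman2019, Lemma 2.6] -/
theorem re_LSeries_twistVonMangoldt_le {ψ : ClassGroup (𝓞 K) →* ℂˣ} (hψ : ψ ≠ 1) {s : ℂ}
    (hs : 1 < s.re) (hs2 : s.re ≤ 2) :
    (LSeries (twistVonMangoldt K (classGroupCharIdealHom ψ)) s).re ≤ 1 + 77760 * discBound K s.im := by
  classical
  set f := classTwistedZeta₁ K (fun C ↦ (ψ C : ℂ)) with hf
  set t : ℝ := s.im with ht
  set c : ℂ := 2 + t * I with hc
  have hsc : s ∈ closedBall c (7 / 4) := by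
    rw [mem_closedBall, dist_eq_norm]
    have : s - c = ((s.re - 2 : ℝ) : ℂ) := by
      apply Complex.ext <;> simp [hc, ht]
    rw [this, Complex.norm_real, Real.norm_eq_abs, abs_le]
    constructor <;> linarith
  have hfs : f s ≠ 0 := classTwistedZeta₁_ne_zero_of_one_lt_re ψ hs
  have hpf := norm_logDeriv_classTwistedZeta₁_sub_sum_le ψ t hsc hfs
  set D := divisor f (closedBall c (31 / 16)) with hD
  set S := (D.finiteSupport (isCompact_closedBall _ _)).toFinset with hS
  have han := analyticOnNhd_classTwistedZeta₁ (K := K) (fun C ↦ (ψ C : ℂ)) (closedBall c (31 / 16))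
  -- every term has non-negative real part
  have hterm_re : ∀ u ∈ S, ((D u : ℂ) / (s - u)).re = (D u : ℝ) * ((s - u)⁻¹).re := fun u _ ↦ by
    rw [div_eq_mul_inv, show ((D u : ℤ) : ℂ) = ((D u : ℝ) : ℂ) by simp, Complex.re_ofReal_mul]
  have hDnn : ∀ u, (0 : ℝ) ≤ D u := fun u ↦ by exact_mod_cast han.divisor_nonneg u
  have hinv_nn : ∀ u ∈ S, 0 ≤ ((s - u)⁻¹).re := by
    intro u hu
    rw [hS, Set.Finite.mem_toFinset, Function.mem_support] at hu
    have huB : u ∈ closedBall c (31 / 16) := D.supportWithinDomain (Function.mem_support.2 hu)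
    have hfu : f u = 0 := by
      rw [hD, divisor_apply han.meromorphicOn huB,
        ((differentiable_classTwistedZeta₁ _).analyticAt u).meromorphicOrderAt_eq] at hu
      by_contra hne
      apply hu
      rw [((differentiable_classTwistedZeta₁ _).analyticAt u).analyticOrderAt_eq_zero.2 hne]
      simp
    have hure := re_le_one_of_classTwistedZeta₁_eq_zero ψ hfu
    rw [Complex.inv_re]
    exact div_nonneg (by simp; linarith) (Complex.normSq_nonneg _)
  have hterm_nn : ∀ u ∈ S, 0 ≤ ((D u : ℂ) / (s - u)).re := fun u hu ↦ by
    rw [hterm_re u hu]; exact mul_nonneg (hDnn u) (hinv_nn u hu)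
  -- the key inequality: `Re 1/(s-1) ≤ 1 + Re Σ`
  have hkey : (1 / (s - 1)).re ≤ 1 + (∑ u ∈ S, (D u : ℂ) / (s - u)).re := by
    have hsum_nn : 0 ≤ (∑ u ∈ S, (D u : ℂ) / (s - u)).re := by
      rw [Complex.re_sum]; exact Finset.sum_nonneg hterm_nn
    have hs1re : (1 / (s - 1)).re = (s.re - 1) / ((s.re - 1) ^ 2 + t ^ 2) := by
      have : s - 1 = ((s.re - 1 : ℝ) : ℂ) + ((t : ℝ) : ℂ) * I := by
        apply Complex.ext <;> simp [ht]
      rw [one_div, this, DirichletZFR.re_inv_ofReal_add_mul_I]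
    by_cases h1 : (1 : ℂ) ∈ closedBall c (31 / 16)
    · -- `1 ∈ S` with multiplicity `≥ 1`
      have hD1 : 1 ≤ D 1 := one_le_divisor_classTwistedZeta₁_one hψ h1
      have h1S : (1 : ℂ) ∈ S := by
        rw [hS, Set.Finite.mem_toFinset, Function.mem_support]
        omega
      have hge : ((D 1 : ℂ) / (s - 1)).re ≤ (∑ u ∈ S, (D u : ℂ) / (s - u)).re := by
        rw [Complex.re_sum]
        exact Finset.single_le_sum hterm_nn h1S
      have hone : (1 / (s - 1)).re ≤ ((D 1 : ℂ) / (s - 1)).re := by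
        rw [hterm_re 1 h1S, one_div]
        have h0 := hinv_nn 1 h1S
        have hD1' : (1 : ℝ) ≤ D 1 := by exact_mod_cast hD1
        nlinarith
      linarith
    · -- `|t| > 1`, so `Re 1/(s-1) ≤ 1`
      have ht2 : 1 ≤ t ^ 2 := by
        rw [mem_closedBall, dist_eq_norm, not_le] at h1
        have hn : ‖(1 : ℂ) - c‖ ^ 2 = 1 + t ^ 2 := by
          have : (1 : ℂ) - c = ((-1 : ℝ) : ℂ) + ((-t : ℝ) : ℂ) * I := by
            apply Complex.ext
            · simp [hc]; norm_num
            · simp [hc]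
          rw [this, ← Complex.normSq_eq_norm_sq, Complex.normSq_add_mul_I]; ring
        nlinarith [norm_nonneg ((1 : ℂ) - c)]
      have hle : (1 / (s - 1)).re ≤ 1 := by
        rw [hs1re, div_le_one (by positivity)]
        nlinarith
      linarith
  have hL : LSeries (twistVonMangoldt K (classGroupCharIdealHom ψ)) s =
      1 / (s - 1) - (∑ u ∈ S, (D u : ℂ) / (s - u)) -
        (logDeriv f s - ∑ u ∈ S, (D u : ℂ) / (s - u)) := by
    rw [logDeriv_classTwistedZeta₁_eq ψ hs]; ring
  rw [hL, Complex.sub_re, Complex.sub_re]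
  have h1 := Complex.abs_re_le_norm (logDeriv f s - ∑ u ∈ S, (D u : ℂ) / (s - u))
  have h2 := neg_abs_le (logDeriv f s - ∑ u ∈ S, (D u : ℂ) / (s - u)).re
  linarith

/-! ### Growth of the entire `L`-function -/

/-- **`|L₀(s, χ)| ≤ 2 |d_K| e^{2n_K} (|t| + 6)^{n_K + 1}` for `−1/2 ≤ σ ≤ 3`**, `χ ≠ 1`: off the disc
`|s − 1| < 1/2` this is `|Z₁_χ(s)| ≤ |d_K| e^{2n_K} |s + 5/2|^{n_K+1}` (`norm_classTwistedZeta₁_le`)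
and `|s − 1| ≥ 1/2`; on it, the maximum modulus principle for the entire `L₀`. [folklore] -/
theorem norm_classGroupLFunction₀_le {χ : ClassGroup (𝓞 K) →* ℂˣ} (hχ : χ ≠ 1) {s : ℂ}
    (hs : -1 / 2 ≤ s.re) (hs3 : s.re ≤ 3) :
    ‖classGroupLFunction₀ K χ s‖ ≤ 2 * ((discr K).natAbs : ℝ) * Real.exp (2 * Module.finrank ℚ K) *
      (|s.im| + 6) ^ (Module.finrank ℚ K + 1) := by
  set n : ℕ := Module.finrank ℚ K with hn
  set d : ℝ := ((discr K).natAbs : ℝ) with hd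
  set E : ℝ := Real.exp (2 * n) with hE
  have ha : ∀ C, ‖(fun C ↦ (χ C : ℂ)) C‖ ≤ 1 := fun C ↦ (norm_classGroupChar_apply χ C).le
  have hd0 : 0 ≤ d := Nat.cast_nonneg _
  -- the bound off the small disc, at any point `w` with `Re w ≥ -1/2`, `|w - 1| ≥ 1/2`
  have hoff : ∀ w : ℂ, -1 / 2 ≤ w.re → 1 / 2 ≤ ‖w - 1‖ →
      ‖classGroupLFunction₀ K χ w‖ ≤ 2 * d * E * ‖w + 5 / 2‖ ^ (n + 1) := by
    intro w hw hw1
    have hw1' : w ≠ 1 := by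
      intro h; rw [h, sub_self, norm_zero] at hw1; linarith
    have hZ := norm_classTwistedZeta₁_le (K := K) ha hw
    rw [← sub_one_mul_classGroupLFunction χ hw1', norm_mul] at hZ
    rw [classGroupLFunction₀_eq χ hw1' hχ]
    have hpos : 0 < ‖w - 1‖ := by linarith
    calc ‖classGroupLFunction K χ w‖ = ‖w - 1‖ * ‖classGroupLFunction K χ w‖ / ‖w - 1‖ := by
          field_simp
      _ ≤ d * E * ‖w + 5 / 2‖ ^ (n + 1) / (1 / 2) := by gcongr
      _ = 2 * d * E * ‖w + 5 / 2‖ ^ (n + 1) := by ring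
  by_cases hcase : 1 / 2 ≤ ‖s - 1‖
  · refine (hoff s hs hcase).trans ?_
    have hn5 : ‖s + 5 / 2‖ ≤ |s.im| + 6 := by
      refine (Complex.norm_le_abs_re_add_abs_im _).trans ?_
      have hre : (s + 5 / 2).re = s.re + 5 / 2 := by simp
      have him : (s + 5 / 2).im = s.im := by simp
      rw [hre, him]
      have : |s.re + 5 / 2| ≤ 11 / 2 := abs_le.mpr ⟨by linarith, by linarith⟩
      linarith
    gcongr
  · -- maximum modulus on `|w - 1| ≤ 1/2`
    rw [not_le] at hcase
    have hC : ∀ w ∈ frontier (ball (1 : ℂ) (1 / 2)),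
        ‖classGroupLFunction₀ K χ w‖ ≤ 2 * d * E * 4 ^ (n + 1) := by
      intro w hw
      rw [frontier_ball (1 : ℂ) (by norm_num), mem_sphere, dist_eq_norm] at hw
      have hwre : -1 / 2 ≤ w.re := by
        have := Complex.abs_re_le_norm (w - 1)
        rw [hw, Complex.sub_re, Complex.one_re, abs_le] at this
        linarith [this.1]
      refine (hoff w hwre hw.ge).trans ?_
      have : ‖w + 5 / 2‖ ≤ 4 := by
        calc ‖w + 5 / 2‖ = ‖(w - 1) + 7 / 2‖ := by ring_nf
          _ ≤ ‖w - 1‖ + ‖(7 / 2 : ℂ)‖ := norm_add_le _ _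
          _ = 4 := by rw [hw]; norm_num
      gcongr
    have hmax := Complex.norm_le_of_forall_mem_frontier_norm_le isBounded_ball
      ((differentiable_classGroupLFunction₀ χ).diffContOnCl) hC
      (subset_closure (mem_ball_iff_norm.mpr hcase))
    refine hmax.trans ?_
    have h4 : (4 : ℝ) ≤ |s.im| + 6 := by linarith [abs_nonneg s.im]
    gcongr

/-! ### The logarithmic derivative and the reflection symmetry of `L₀` -/

/-- On `Re s > 1`: `L₀'/L₀(s, χ) = −L(Λ_χ, s)` (`χ ≠ 1`). [folklore] -/
theorem logDeriv_classGroupLFunction₀_eq {χ : ClassGroup (𝓞 K) →* ℂˣ} (hχ : χ ≠ 1) {s : ℂ}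
    (hs : 1 < s.re) :
    deriv (classGroupLFunction₀ K χ) s / classGroupLFunction₀ K χ s =
      -LSeries (twistVonMangoldt K (classGroupCharIdealHom χ)) s := by
  have hs1 : s ≠ 1 := fun h ↦ by rw [h, one_re] at hs; exact lt_irrefl _ hs
  have hev : classGroupLFunction₀ K χ =ᶠ[𝓝 s] classGroupLFunction K χ := by
    filter_upwards [isOpen_compl_singleton.mem_nhds hs1] with z hz
    exact classGroupLFunction₀_eq χ hz hχ
  rw [hev.deriv_eq, classGroupLFunction₀_eq χ hs1 hχ, ← neg_logDeriv_classGroupLFunction_eq K χ hs,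
    neg_neg]

/-- `ν_χ` is real-valued for a real character: `conj ν_χ(𝔞) = ν_χ(𝔞)` (`χ² = 1`). [folklore] -/
theorem conj_classGroupCharIdealHom {χ : ClassGroup (𝓞 K) →* ℂˣ} (h2 : χ * χ = 1) (I : Ideal (𝓞 K)) :
    conj (classGroupCharIdealHom χ I) = classGroupCharIdealHom χ I := by
  by_cases hI : I = ⊥
  · rw [hI, classGroupCharIdealHom_bot, map_zero]
  · rw [classGroupCharIdealHom_apply_of_ne_bot χ hI, classGroupChar_apply_eq_ofReal_re h2,
      Complex.conj_ofReal]

/-- Conjugation symmetry on `Re s > 1` for a real character: `conj L(conj s, χ) = L(s, χ)`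
(the Dirichlet coefficients `Σ_{N𝔞 = n} χ(𝔞)` are real). [folklore] -/
theorem conj_classGroupLFunction_conj_of_one_lt_re {χ : ClassGroup (𝓞 K) →* ℂˣ} (h2 : χ * χ = 1)
    {s : ℂ} (hs : 1 < s.re) :
    conj (classGroupLFunction K χ (conj s)) = classGroupLFunction K χ s := by
  have hs' : 1 < (conj s).re := by rwa [Complex.conj_re]
  rw [← LSeries_twistCount_classGroupCharIdealHom K χ hs', ← LSeries_twistCount_classGroupCharIdealHom K χ hs,
    LSeries, LSeries, Complex.conj_tsum]
  congr 1
  funext n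
  rcases eq_or_ne n 0 with rfl | hn
  · simp [LSeries.term]
  · rw [LSeries.term_of_ne_zero hn, LSeries.term_of_ne_zero hn, map_div₀]
    congr 1
    · rw [twistCount, map_sum]
      exact Finset.sum_congr rfl fun I _ ↦ conj_classGroupCharIdealHom h2 I
    · have harg : Complex.arg ((n : ℕ) : ℂ) ≠ Real.pi := by
        rw [show ((n : ℕ) : ℂ) = ((n : ℝ) : ℂ) by push_cast; rfl,
          Complex.arg_ofReal_of_nonneg (Nat.cast_nonneg n)]
        exact Real.pi_ne_zero.symm
      calc conj (((n : ℕ) : ℂ) ^ (conj s)) = conj ((conj ((n : ℕ) : ℂ)) ^ (conj s)) := by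
            rw [Complex.conj_natCast]
        _ = ((n : ℕ) : ℂ) ^ (conj (conj s)) := (Complex.cpow_conj _ _ harg).symm
        _ = ((n : ℕ) : ℂ) ^ s := by rw [Complex.conj_conj]

/-- **Reflection principle for a real class group character** `χ ≠ 1`, `χ² = 1`:
`conj L₀(conj s, χ) = L₀(s, χ)` on all of `ℂ` (identity theorem from `Re s > 1`).
[cite: MontgomeryVaughan2007, Theorem 11.3 (proof, Case 3)] -/
theorem conj_classGroupLFunction₀_conj {χ : ClassGroup (𝓞 K) →* ℂˣ} (hχ : χ ≠ 1) (h2 : χ * χ = 1)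
    (s : ℂ) : conj (classGroupLFunction₀ K χ (conj s)) = classGroupLFunction₀ K χ s := by
  have hf : AnalyticOnNhd ℂ (classGroupLFunction₀ K χ) Set.univ := fun z _ ↦
    (differentiable_classGroupLFunction₀ χ).analyticAt z
  have hgdiff : Differentiable ℂ (conj ∘ classGroupLFunction₀ K χ ∘ conj) := fun _ ↦
    differentiableAt_conj_conj_iff.mpr (differentiable_classGroupLFunction₀ χ _)
  have hg : AnalyticOnNhd ℂ (conj ∘ classGroupLFunction₀ K χ ∘ conj) Set.univ := fun z _ ↦
    hgdiff.analyticAt z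
  have hfg : (conj ∘ classGroupLFunction₀ K χ ∘ conj) =ᶠ[𝓝 (2 : ℂ)] classGroupLFunction₀ K χ := by
    have hmem : {s : ℂ | 1 < s.re} ∈ 𝓝 (2 : ℂ) :=
      (isOpen_lt continuous_const continuous_re).mem_nhds (by simp)
    filter_upwards [hmem] with w hw
    have hw1 : w ≠ 1 := fun h ↦ by rw [h, one_re] at hw; exact lt_irrefl _ hw
    have hw1' : conj w ≠ 1 := fun h ↦ hw1 (by rw [← Complex.conj_conj w, h, map_one])
    simp only [Function.comp_apply]
    rw [classGroupLFunction₀_eq χ hw1' hχ, classGroupLFunction₀_eq χ hw1 hχ]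
    exact conj_classGroupLFunction_conj_of_one_lt_re h2 hw
  have := hg.eqOn_of_preconnected_of_eventuallyEq hf isPreconnected_univ (Set.mem_univ _) hfg
    (Set.mem_univ s)
  simpa using this

/-- The zeros of `L₀(·, χ)` for a real `χ ≠ 1` are symmetric under conjugation. [folklore] -/
theorem classGroupLFunction₀_conj_eq_zero {χ : ClassGroup (𝓞 K) →* ℂˣ} (hχ : χ ≠ 1) (h2 : χ * χ = 1)
    {ρ : ℂ} (hρ : classGroupLFunction₀ K χ ρ = 0) : classGroupLFunction₀ K χ (conj ρ) = 0 := by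
  have h := conj_classGroupLFunction₀_conj hχ h2 (conj ρ)
  rw [Complex.conj_conj, hρ, map_zero] at h
  exact h.symm

/-- `ν_1 = 𝟙` (the trivial twist). [folklore] -/
theorem classGroupCharIdealHom_one : classGroupCharIdealHom (1 : ClassGroup (𝓞 K) →* ℂˣ) = trivialChar K := by
  ext I
  by_cases hI : I = ⊥
  · rw [hI, classGroupCharIdealHom_bot]
    simp [trivialChar]
  · rw [classGroupCharIdealHom_apply_of_ne_bot _ hI, MonoidHom.one_apply, Units.val_one]
    simp [trivialChar, hI]

/-! ### The datum -/

section Datum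

/-- The numeric parameters of the datum are admissible (`A ≥ 0`, `C_g, c₁ > 0`, `K₀, C₂ ≥ 0`).
[folklore] -/
theorem zfrParams_nonneg (n : ℕ) :
    (0 : ℝ) ≤ n + 1 ∧ (0 : ℝ) < 2 * Real.exp (2 * n) * (3 / 2) ^ (n + 1) ∧
      (0 : ℝ) < 32 * Real.exp (-(32 * n)) ∧ (0 : ℝ) ≤ 77760 * (5 * n + 2) ∧
      (0 : ℝ) ≤ 77760 * (5 * n + 2) + 1 :=
  ⟨by positivity, by positivity, by positivity, by positivity, by positivity⟩

/-- The fields of `UniformTwistedZFRData` shared by both cases (everything except `pole`-dependent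
`re_LSeries₂_le` and `reflect`), for `χ ≠ 1`, `Q = |d_K|`, `η = 1`. [folklore] -/
theorem zfrData_common {χ : ClassGroup (𝓞 K) →* ℂˣ} (hχ : χ ≠ 1) :
    let n : ℕ := Module.finrank ℚ K
    (1 : ℝ) ≤ ((discr K).natAbs : ℝ) ∧
    (∀ σ : ℝ, 1 < σ → σ ≤ 2 →
      (LSeries (fun m ↦ (vonMangoldtNorm K m : ℂ)) σ).re ≤
        1 / (σ - 1) + 77760 * (5 * (n : ℝ) + 2) * (Real.log ((discr K).natAbs : ℝ) + Real.log 4)) ∧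
    (∀ s : ℂ, 1 - (1 : ℝ) < s.re → s.re ≤ 3 →
      ‖classGroupLFunction₀ K χ s‖ ≤ 2 * Real.exp (2 * n) * (3 / 2) ^ (n + 1) *
        ((discr K).natAbs : ℝ) ^ ((n : ℝ) + 1) * (|s.im| + 4) ^ ((n : ℝ) + 1)) ∧
    (∀ t : ℝ, 32 * Real.exp (-(32 * (n : ℝ))) * ((1 : ℝ) / 32) ≤
      ‖classGroupLFunction₀ K χ (1 + (1 : ℝ) / 32 + t * I)‖) := by
  intro n
  have hd1 : (1 : ℝ) ≤ ((discr K).natAbs : ℝ) := by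
    have h := Int.one_le_abs (NumberField.discr_ne_zero K)
    rw [Int.abs_eq_natAbs] at h
    exact_mod_cast h
  refine ⟨hd1, fun σ hσ hσ2 ↦ re_LSeries_vonMangoldtNorm_ofReal_le hσ hσ2, fun s hs hs3 ↦ ?_, fun t ↦ ?_⟩
  · -- growth
    have hs' : -1 / 2 ≤ s.re := by linarith
    refine (norm_classGroupLFunction₀_le hχ hs' hs3).trans ?_
    have hτ : 0 ≤ |s.im| + 4 := by positivity
    have h1 : (|s.im| + 6) ^ (n + 1) ≤ (3 / 2) ^ (n + 1) * (|s.im| + 4) ^ ((n : ℝ) + 1) := by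
      rw [show ((n : ℝ) + 1) = ((n + 1 : ℕ) : ℝ) by push_cast; ring, Real.rpow_natCast, ← mul_pow]
      exact pow_le_pow_left₀ (by positivity) (by linarith [abs_nonneg s.im]) _
    have h2 : ((discr K).natAbs : ℝ) ≤ ((discr K).natAbs : ℝ) ^ ((n : ℝ) + 1) := by
      calc ((discr K).natAbs : ℝ) = ((discr K).natAbs : ℝ) ^ (1 : ℝ) := (Real.rpow_one _).symm
        _ ≤ ((discr K).natAbs : ℝ) ^ ((n : ℝ) + 1) :=
          Real.rpow_le_rpow_of_exponent_le hd1 (by linarith [n.cast_nonneg (α := ℝ)])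
    have hE : 0 ≤ Real.exp (2 * n) := (Real.exp_pos _).le
    calc 2 * ((discr K).natAbs : ℝ) * Real.exp (2 * n) * (|s.im| + 6) ^ (n + 1)
        ≤ 2 * ((discr K).natAbs : ℝ) ^ ((n : ℝ) + 1) * Real.exp (2 * n) *
            ((3 / 2) ^ (n + 1) * (|s.im| + 4) ^ ((n : ℝ) + 1)) := by gcongr
      _ = _ := by ring
  · -- lower bound at the disc centre
    have hre : (1 + (1 : ℝ) / 32 + t * I : ℂ).re = 1 + 1 / 32 := by simp
    have hs1 : 1 < (1 + (1 : ℝ) / 32 + t * I : ℂ).re := by rw [hre]; norm_num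
    have hne : (1 + (1 : ℝ) / 32 + t * I : ℂ) ≠ 1 := fun h ↦ by
      have := congrArg Complex.re h; rw [hre, one_re] at this; norm_num at this
    rw [classGroupLFunction₀_eq χ hne hχ]
    refine le_trans (le_of_eq ?_) (exp_neg_finrank_div_le_norm_classGroupLFunction K χ hs1)
    rw [hre, show (32 : ℝ) * Real.exp (-(32 * (n : ℝ))) * (1 / 32) = Real.exp (-(32 * (n : ℝ))) by ring]
    congr 1
    rw [show (1 : ℝ) + 1 / 32 - 1 = 1 / 32 by norm_num]
    ring

/-- **The datum for `χ² ≠ 1`** (`pole = false`): `UniformTwistedZFRData` for `F = L₀(·, χ)`,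
`Q = |d_K|`, `η = 1`, `A = n_K + 1`, `C_g = 2e^{2n_K}(3/2)^{n_K+1}`, `c₁ = 32e^{−32n_K}`,
`K₀ = 77760(5n_K + 2)`, `C₂ = 77760(5n_K + 2) + 1`, `Λ₀ = Λ_K`, `Λ₁ = Λ_χ`, `Λ₂ = Λ_{χ²}`.
[cite: ThornerZaman2019, Theorem 3.1] -/
theorem uniformTwistedZFRData_classGroupLFunction₀_of_ne {χ : ClassGroup (𝓞 K) →* ℂˣ}
    (h2 : χ * χ ≠ 1) :
    UniformTwistedZFRData 1 (Module.finrank ℚ K + 1)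
      (2 * Real.exp (2 * Module.finrank ℚ K) * (3 / 2) ^ (Module.finrank ℚ K + 1))
      (32 * Real.exp (-(32 * Module.finrank ℚ K))) (77760 * (5 * Module.finrank ℚ K + 2))
      (77760 * (5 * Module.finrank ℚ K + 2) + 1) false ((discr K).natAbs : ℝ)
      (vonMangoldtNorm K) (twistVonMangoldt K (classGroupCharIdealHom χ))
      (twistVonMangoldt K (classGroupCharIdealHom (χ * χ))) (classGroupLFunction₀ K χ) := by
  have hχ : χ ≠ 1 := fun h ↦ h2 (by rw [h]; exact mul_one (1 : ClassGroup (𝓞 K) →* ℂˣ))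
  obtain ⟨hd1, h0, hgr, hlow⟩ := zfrData_common (K := K) hχ
  obtain ⟨hA, hCg, hc₁, hK₀, hC₂⟩ := zfrParams_nonneg (Module.finrank ℚ K)
  exact {
    eta_pos := one_pos
    eta_le_one := le_rfl
    A_nonneg := hA
    Cg_pos := hCg
    c₁_pos := hc₁
    K₀_nonneg := hK₀
    C₂_nonneg := hC₂
    one_le_Q := hd1
    nonneg := vonMangoldtNorm_nonneg
    summable := fun s hs ↦ LSeriesSummable_vonMangoldtNorm hs
    re_LSeries₀_le := h0
    norm_le₁ := norm_twistVonMangoldt_le (norm_classGroupCharIdealHom_le χ)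
    norm_le₂ := norm_twistVonMangoldt_le (norm_classGroupCharIdealHom_le (χ * χ))
    three_four_one := fun σ hσ t ↦ three_four_one_classGroupChar K χ hσ t
    differentiableOn := (differentiable_classGroupLFunction₀ χ).differentiableOn
    ne_zero := fun s hs ↦ by
      have hs1 : s ≠ 1 := fun h ↦ by rw [h, one_re] at hs; exact lt_irrefl _ hs
      rw [classGroupLFunction₀_eq χ hs1 hχ]
      exact classGroupLFunction_ne_zero_of_one_lt_re K χ hs
    logDeriv_eq := fun s hs ↦ logDeriv_classGroupLFunction₀_eq hχ hs
    growth := fun s hs hs3 ↦ by simpa using hgr s hs hs3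
    lower := fun t ↦ by simpa using hlow t
    re_LSeries₂_le := fun s hs hs2 ↦ by
      have h := re_LSeries_twistVonMangoldt_le (K := K) h2 hs hs2
      have hM := discBound_le (K := K) s.im
      simp only [Bool.false_eq_true, ↓reduceIte, zero_add]
      nlinarith [ClassicalZFRData.one_le_log_tau s.im, Real.log_natCast_nonneg (discr K).natAbs]
    reflect := fun h ↦ absurd h Bool.false_ne_true }

/-- **The datum for a real character** (`χ² = 1`, `χ ≠ 1`, `pole = true`): as above with
`Λ₂ = Λ_{χ²} = Λ_K`, the companion bound being the Stark-type bound for `−ζ_K'/ζ_K`, and the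
reflection symmetry from `conj L₀(conj s, χ) = L₀(s, χ)`. [cite: ThornerZaman2019, Theorem 3.1] -/
theorem uniformTwistedZFRData_classGroupLFunction₀_of_eq {χ : ClassGroup (𝓞 K) →* ℂˣ} (hχ : χ ≠ 1)
    (h2 : χ * χ = 1) :
    UniformTwistedZFRData 1 (Module.finrank ℚ K + 1)
      (2 * Real.exp (2 * Module.finrank ℚ K) * (3 / 2) ^ (Module.finrank ℚ K + 1))
      (32 * Real.exp (-(32 * Module.finrank ℚ K))) (77760 * (5 * Module.finrank ℚ K + 2))
      (77760 * (5 * Module.finrank ℚ K + 2) + 1) true ((discr K).natAbs : ℝ)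
      (vonMangoldtNorm K) (twistVonMangoldt K (classGroupCharIdealHom χ))
      (twistVonMangoldt K (classGroupCharIdealHom (χ * χ))) (classGroupLFunction₀ K χ) := by
  obtain ⟨hd1, h0, hgr, hlow⟩ := zfrData_common (K := K) hχ
  obtain ⟨hA, hCg, hc₁, hK₀, hC₂⟩ := zfrParams_nonneg (Module.finrank ℚ K)
  exact {
    eta_pos := one_pos
    eta_le_one := le_rfl
    A_nonneg := hA
    Cg_pos := hCg
    c₁_pos := hc₁
    K₀_nonneg := hK₀
    C₂_nonneg := hC₂
    one_le_Q := hd1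
    nonneg := vonMangoldtNorm_nonneg
    summable := fun s hs ↦ LSeriesSummable_vonMangoldtNorm hs
    re_LSeries₀_le := h0
    norm_le₁ := norm_twistVonMangoldt_le (norm_classGroupCharIdealHom_le χ)
    norm_le₂ := norm_twistVonMangoldt_le (norm_classGroupCharIdealHom_le (χ * χ))
    three_four_one := fun σ hσ t ↦ three_four_one_classGroupChar K χ hσ t
    differentiableOn := (differentiable_classGroupLFunction₀ χ).differentiableOn
    ne_zero := fun s hs ↦ by
      have hs1 : s ≠ 1 := fun h ↦ by rw [h, one_re] at hs; exact lt_irrefl _ hs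
      rw [classGroupLFunction₀_eq χ hs1 hχ]
      exact classGroupLFunction_ne_zero_of_one_lt_re K χ hs
    logDeriv_eq := fun s hs ↦ logDeriv_classGroupLFunction₀_eq hχ hs
    growth := fun s hs hs3 ↦ by simpa using hgr s hs hs3
    lower := fun t ↦ by simpa using hlow t
    re_LSeries₂_le := fun s hs hs2 ↦ by
      have hΛ : twistVonMangoldt K (classGroupCharIdealHom (χ * χ)) =
          fun m ↦ (vonMangoldtNorm K m : ℂ) := by
        rw [h2, classGroupCharIdealHom_one]
        funext m
        exact twistVonMangoldt_trivialChar m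
      rw [hΛ]
      have h := re_LSeries_vonMangoldtNorm_le (K := K) hs hs2
      have hM := discBound_le (K := K) s.im
      simp only [↓reduceIte]
      nlinarith [ClassicalZFRData.one_le_log_tau s.im, Real.log_natCast_nonneg (discr K).natAbs]
    reflect := fun _ ρ _ hρ ↦ classGroupLFunction₀_conj_eq_zero hχ h2 hρ }

end Datum

/-! ### The zero-free region -/

/-- **Zero-free region for class group `L`-functions, uniformly in the field**
([ThornerZaman2019, Theorem 3.1] for `χ ≠ 1`; Lagarias–Odlyzko Lemma 8.1): for every degree `n`
there is `c = c(n) > 0` such that for every number field `K` with `[K : ℚ] = n`, every class group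
character `χ ≠ 1` of `K` and every zero `ρ` of the entire function `L₀(s, χ)` (= `L(s, χ)` off
`s = 1`) with `Re ρ > 1 − c/(log|d_K| + log(|Im ρ| + 4))`, the character is real (`χ² = 1`) and
the zero is real (`Im ρ = 0`). [cite: ThornerZaman2019, Theorem 3.1] -/
theorem exists_zeroFree_classGroupLFunction₀ (n : ℕ) :
    ∃ c : ℝ, 0 < c ∧ ∀ (K : Type) [Field K] [NumberField K], Module.finrank ℚ K = n →
      ∀ χ : ClassGroup (𝓞 K) →* ℂˣ, χ ≠ 1 → ∀ ρ : ℂ, classGroupLFunction₀ K χ ρ = 0 →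
        1 - c / (Real.log ((discr K).natAbs : ℝ) + Real.log (|ρ.im| + 4)) < ρ.re →
          χ * χ = 1 ∧ ρ.im = 0 := by
  obtain ⟨hA, -, -, hK₀, hC₂⟩ := zfrParams_nonneg n
  obtain ⟨c, hc, hzf⟩ := UniformTwistedZFRData.exists_zeroFree_const
    (η := 1) (A := (n : ℝ) + 1) (Cg := 2 * Real.exp (2 * n) * (3 / 2) ^ (n + 1))
    (c₁ := 32 * Real.exp (-(32 * n))) (K₀ := 77760 * (5 * n + 2)) (C₂ := 77760 * (5 * n + 2) + 1)
    one_pos hA hK₀ hC₂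
  refine ⟨c, hc, fun K _ _ hK χ hχ ρ hρ hregion ↦ ?_⟩
  subst hK
  by_cases h2 : χ * χ = 1
  · have hdat := uniformTwistedZFRData_classGroupLFunction₀_of_eq hχ h2
    exact ⟨h2, (hzf _ _ _ _ _ _ (by exact_mod_cast hdat) ρ hρ hregion).2⟩
  · have hdat := uniformTwistedZFRData_classGroupLFunction₀_of_ne h2
    have := (hzf _ _ _ _ _ _ (by exact_mod_cast hdat) ρ hρ hregion).1
    exact absurd this Bool.false_ne_true

/-- The same for `L(s, χ)` itself (`s ≠ 1`). [cite: ThornerZaman2019, Theorem 3.1] -/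
theorem exists_zeroFree_classGroupLFunction (n : ℕ) :
    ∃ c : ℝ, 0 < c ∧ ∀ (K : Type) [Field K] [NumberField K], Module.finrank ℚ K = n →
      ∀ χ : ClassGroup (𝓞 K) →* ℂˣ, χ ≠ 1 → ∀ ρ : ℂ, ρ ≠ 1 → classGroupLFunction K χ ρ = 0 →
        1 - c / (Real.log ((discr K).natAbs : ℝ) + Real.log (|ρ.im| + 4)) < ρ.re →
          χ * χ = 1 ∧ ρ.im = 0 := by
  obtain ⟨c, hc, h⟩ := exists_zeroFree_classGroupLFunction₀ n
  refine ⟨c, hc, fun K _ _ hK χ hχ ρ hρ1 hρ hregion ↦ h K hK χ hχ ρ ?_ hregion⟩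
  rw [classGroupLFunction₀_eq χ hρ1 hχ, hρ]

end Literature.NumberTheory.LFunctions.NumberField

end
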